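import Literature.NumberTheory.EllipticCurves.ModularJacobianModPMultiplicityOne
import Literature.NumberTheory.GaloisRepresentations.IntegralGaloisAction
import Mathlib.FieldTheory.IsAlgClosed.Basic
import HarnessLib

/-!
# Mod `2` multiplicity one for `J₀(N)[𝔪]`, `N` odd (Buzzard 2000, Def. 2.1–2.2 and Prop. 2.4)

The `ℓ = 2` companion of `wiles1995_multiplicityOne` (`ModularJacobianModPMultiplicityOne.lean`, which
excludes `ℓ = 2` as printed in Darmon–Diamond–Taylor Thm. 4.26). Same carriers, nothing new is defined:
`HeckeRing0 N 2 = 𝕋_ℤ = ℤ[T_p : p prime] ⊆ End_ℂ S₂(Γ₀(N))`, `J0 N = S₂(Γ₀(N))^∨ ⧸ H₁(X₀(N), ℤ)` with its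
`𝕋_ℤ`-action, `ModPGaloisRep`, `HasFrobCharpolyAt`, `Ideal.decompositionSubgroup`, `primesAbove`.

Source, AS PRINTED. K. Buzzard, *On level-lowering for mod 2 representations*, Math. Res. Lett. 7 (2000)
95–110 [Buzzard2000LevelLoweringModTwo] (held text `paper:doi-10-4310-mrl-2000-v7-n1-a9`), §2, p. 100–101:
"Let `M ≥ 1` be an integer. Let `Γ` be a group with `Γ₁(M) ⊆ Γ ⊆ Γ₀(M)`. Let `X(Γ)` denote the associated
compactified modular curve (viewed over the complexes) and let `J(Γ)` denote its Jacobian. Let `T` be the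
Hecke algebra in `End(J(Γ))` generated (via Picard functoriality) by the Hecke operators `T_n`, `n ≥ 1` and
the diamond operators `d_M` for `d ∈ (ℤ/Mℤ)^×`. Then `T` is a finite free `ℤ`-module. Let `m` denote a
maximal ideal of `T` containing `2`.
DEFINITION 2.1. With notation as above, we say that `m` satisfies multiplicity one if the finite group
`J(Γ)[m]` has `T/m`-dimension `2`.
Recall that one can associate to `m`, as above, a semisimple Galois representation `Gal(ℚ̄/ℚ) → GL₂(𝔽̄₂)`
(after choosing an embedding `T/m → 𝔽̄₂`). Now let `ρ : Gal(ℚ̄/ℚ) → GL₂(𝔽̄₂)` be an irreducible modular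
representation. […]
DEFINITION 2.2 — finite case. If `ρ` is finite at `2`, then say that `ρ` satisfies multiplicity one if, for
all odd `M`, and for all groups `Γ` with `Γ₁(M) ⊆ Γ ⊆ Γ₀(M)`, and `m` as above, such that `ρ_m ≅ ρ` (after
some choice of embedding `T/m → 𝔽̄₂`), the ideal `m` satisfies multiplicity one.
DEFINITION 2.2 — non-finite case. If `ρ` is not finite at `2`, then `ρ` can never arise as the mod `2`
representation associated to a modular form of weight `2` and odd level. […]
PROPOSITION 2.4. If `ρ : Gal(ℚ̄/ℚ) → GL₂(𝔽̄₂)` is irreducible and modular, and `ρ` restricted to a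
decomposition group at `2` is not contained within the scalar matrices, then `ρ` satisfies multiplicity one."

Reading used here (the module docstring of the odd-`ℓ` file applies verbatim otherwise). Take `Γ = Γ₀(N)`,
`N` odd (allowed as printed: `Γ₁(N) ⊆ Γ₀(N) ⊆ Γ₀(N)`; the diamond operators act trivially on `J(Γ₀(N)) =
J₀(N)`, and `ℤ[T_n : n ≥ 1] = ℤ[T_p : p prime]`, so `T = 𝕋_ℤ = HeckeRing0 N 2`); `𝔪 ∋ 2` a maximal ideal
of `𝕋_ℤ`; `ρ : G_ℚ → GL₂(k)`, `k ⊇ 𝕋/𝔪` algebraically closed of characteristic `2` (the printed `𝔽̄₂`;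
discrete topology), with `ρ ≅ ρ_𝔪`, i.e. unramified at `p ∤ 2N` with the Eichler–Shimura characteristic
polynomials `X² − (T_p mod 𝔪) X + p` (this characterises the semisimple `ρ_𝔪 ⊗ k`; `ρ` irreducible over the
algebraically closed `k` is then `≅ ρ_𝔪 ⊗ k` by Brauer–Nesbitt, and "modular" holds by construction);
`ρ` irreducible; and, verbatim, "`ρ` restricted to a decomposition group at `2` is not contained within the
scalar matrices": for every prime `𝔓` of `ℤ̄` above `2` some `σ ∈ D_𝔓` has `ρ(σ)` non-scalar. Since `N` is
odd, `ρ = ρ_𝔪` arises in weight `2` at odd level, so by the printed sentence of Def. 2.2 (non-finite case) it is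
finite at `2` and the finite case of Def. 2.2 applies. Conclusion (Def. 2.1 for `Γ = Γ₀(N)`):
`dim_{𝕋/𝔪} J₀(N)[𝔪] = 2`, on the tree's `J0 N` (all complex points; `J(Γ)[m]` is the `m`-torsion of
`J(Γ)(ℂ)`). The Picard-versus-dual (Albanese) normalisation of the Hecke action on `J0 N` changes `J₀(N)[𝔪]`
by the Atkin–Lehner automorphism `w_N` (`T ↦ w_N T w_N⁻¹`), not its dimension — the same reading as in the
odd-`ℓ` file. For a weight-`2` eigensystem of odd level, SUPERSINGULAR at `2` (`T₂ ∈ 𝔪`) implies that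
`ρ_𝔪|_{I₂}` acts through the level-`2` fundamental characters `ω₂ ⊕ ω₂²` (Ribet–Stein, *Lectures on Serre's
Conj.* [RibetStein2008] Prop. 3.7 and §2.2, after Fontaine / Edixhoven 1992 Thm. 2.6), in particular is
non-scalar on `D₂`; that passage is NOT part of this fact (consumers supply the non-scalar hypothesis).
Kilford's level-`503` examples (Ribet–Stein Remark 3.6) where mod-`2` multiplicity one FAILS have `ρ`
unramified at `2` with `ρ(Frob₂)` scalar — excluded by the hypothesis, as Buzzard remarks (p. 96: "in the
case where the restriction of `ρ` to a decomposition group at `2` is contained in the scalars, the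
multiplicity one result alluded to above does not appear to be known").
-- TODO(general form): the printed statement covers every `Γ` with `Γ₁(M) ⊆ Γ ⊆ Γ₀(M)` (with the diamond
-- operators in `T`); the tree has only the `Γ₀(N)` Jacobian carrier `J0 N`.

## References

* K. Buzzard, On level-lowering for mod 2 representations, Math. Res. Lett. 7 (2000) 95–110
  [Buzzard2000LevelLoweringModTwo] (doi 10.4310/mrl.2000.v7.n1.a9), Def. 2.1, Def. 2.2, Prop. 2.4 (p. 100–101).
* K. A. Ribet, W. A. Stein, Lectures on Serre's Conj. [RibetStein2008], Def. 3.3, Thm. 3.5, Remark 3.6,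
  Prop. 3.7; Appendix by K. Buzzard, Thm. 6.1 (the `J₁(N)` statements).
* B. Mazur, Modular curves and the Eisenstein ideal, Publ. Math. IHÉS 47 (1977), Prop. II.14.2 (prime level).
* H. Darmon, F. Diamond, R. Taylor, Fermat's Last Theorem, Thm. 4.26 [DarmonDiamondTaylor1995]
  (the odd-`ℓ` statement mirrored by this file's shape).
-/

noncomputable section

open scoped MatrixGroups ModularForm NumberField

open CongruenceSubgroup Polynomial IsDedekindDomain

namespace Literature.NumberTheory.EllipticCurves.ModularForms

section Fact

open GaloisRepresentations Rat.HeightOneSpectrum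

/-- **Mod `2` multiplicity one for `J₀(N)[𝔪]`, `N` odd, at a maximal ideal whose Galois representation
is irreducible and non-scalar on a decomposition group at `2`** — Buzzard, *On level-lowering for mod 2
representations* [Buzzard2000LevelLoweringModTwo], **Prop. 2.4** with **Def. 2.1–2.2** (p. 100–101): "If
`ρ : Gal(ℚ̄/ℚ) → GL₂(𝔽̄₂)` is irreducible and modular, and `ρ` restricted to a decomposition group at `2`
is not contained within the scalar matrices, then `ρ` satisfies multiplicity one", i.e. (Def. 2.2, finite
case — automatic at odd level — and Def. 2.1) "for all odd `M`, and for all groups `Γ` with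
`Γ₁(M) ⊆ Γ ⊆ Γ₀(M)`, and `m` […] such that `ρ_m ≅ ρ` […] the finite group `J(Γ)[m]` has `T/m`-dimension
`2`", read at `Γ = Γ₀(N)` on the tree's `J0 N` with `T = 𝕋_ℤ = HeckeRing0 N 2` (see the module docstring;
`TODO(general form)` there for the intermediate groups `Γ`). Hypotheses: `N` odd; `𝔪 ∋ 2` maximal;
`k ⊇ 𝕋/𝔪` algebraically closed (discrete topology) carrying `ρ : G_ℚ → GL₂(k)` unramified at `p ∤ 2N` with
`charpoly ρ(Frob_p) = X² − (T_p mod 𝔪) X + p` (`ρ ≅ ρ_𝔪`), `ρ` irreducible, and for every prime `𝔓 ∣ 2`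
of `ℤ̄` an element of the decomposition group `D_𝔓` at which `ρ` is not a scalar matrix. Conclusion:
`dim_{𝕋/𝔪} J₀(N)[𝔪] = 2`. [cite: Buzzard2000LevelLoweringModTwo, Prop. 2.4 and Def. 2.1–2.2 (p. 100–101)] -/
def buzzard2000_multiplicityOne_gamma0 : Prop :=
  ∀ (N : ℕ) [NeZero N], Odd N →
    ∀ (𝔪 : Ideal (HeckeRing0 N 2)), 𝔪.IsMaximal → (2 : HeckeRing0 N 2) ∈ 𝔪 →
    ∀ (k : Type) [Field k] [IsAlgClosed k] [TopologicalSpace k] [DiscreteTopology k]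
      (ι : HeckeRing0 N 2 ⧸ 𝔪 →+* k) (ρ : ModPGaloisRep ℚ k 2),
      (∀ v : HeightOneSpectrum (𝓞 ℚ), ¬ ((primesEquiv v : Nat.Primes) : ℕ) ∣ 2 * N →
        ρ.IsUnramifiedAt v ∧
          ρ.HasFrobCharpolyAt v
            (X ^ 2
              - C (ι (Ideal.Quotient.mk 𝔪 (HeckeRing0.T N 2
                  ((primesEquiv v : Nat.Primes) : ℕ) (primesEquiv v : Nat.Primes).2))) * X
              + C (((primesEquiv v : Nat.Primes) : ℕ) : k))) →
      FramedRep.IsIrreducible ρ →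
      (∀ v : HeightOneSpectrum (𝓞 ℚ), ((primesEquiv v : Nat.Primes) : ℕ) = 2 →
        ∀ 𝔓 ∈ v.primesAbove, ∃ σ ∈ 𝔓.decompositionSubgroup (Field.absoluteGaloisGroup ℚ),
          ∀ c : k, ((ρ σ : GL (Fin 2) k) : Matrix (Fin 2) (Fin 2) k) ≠ Matrix.scalar (Fin 2) c) →
      Module.finrank (HeckeRing0 N 2 ⧸ 𝔪)
          (Submodule.torsionBySet (HeckeRing0 N 2) (J0 N) 𝔪) = 2

end Fact

end Literature.NumberTheory.EllipticCurves.ModularForms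

end
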